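import Mathlib
import HarnessLib
import HarnessLib.Audit
import Summits.CriticalPhenomena.Statement
import Literature.Probability.RandomPlanarGeometry.ChordalCurveFamily
import Literature.Probability.RandomPlanarGeometry.LoopSpaceMaps
import HarnessLib.Audit.Status.Attr

/-!
Route: SAWPoissonBanks

# Route SAWPoissonBanks — Poissonian banks — the SAW's one-sided fills are asymptotically
union-infinitely-divisible; generator rigidity gives SLE(8/3)

It suffices to show X = (PB) ∧ (PR) ∧ (L) ∧ (A) [route realising idea card
poissonian-banks-matheron, "the banks of the critical SAW are Poisson seas"]:
 (PB) PoissonianBanks (lattice, inequalities only): for the critical δℤ² SAW in every Dobrushin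
domain (D; a, b), every side j and every finite family B, F₀, …, F_n of Dobrushin sub-domains
obtained from D by removing hulls attached to the arc opposite to D.arc j (same marked points, D.arc
j kept in the frontier, agreeing with D near a and b), the avoidance probabilities q_δ(S) = P_δ(γ ⊆
cl B ∩ ⋂_(i∈S) cl F_i) satisfy Matheron's complete-alternation tower asymptotically: Π_(|S| odd)
q_δ(S) ≤ Π_(|S| even) q_δ(S) + o(1) as δ → 0⁺ (order 1 = monotonicity, order 2 = same-side positive
association, all orders ⟺ −log q is the hitting capacity of a σ-finite measure ⟺ the bank is the
fill of a Poisson germ process, Molchanov2017 Ch. 4 Thm 1.6; exactly true for SLE_8/3 by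
Werner2005ConformalRestriction Thm 8);
 (PR) PoissonRigidity (continuum, new mathematics): a chordal family on Dobrushin domains with
two-sided restriction, the restriction-coupled domain Markov property, reversibility, covariance
under z ↦ r·i^k·z + w and conjugation, carried by simple boundary-avoiding curves, AND whose banks
on both sides satisfy the exact alternation tower in every domain (both one-sided fills are Poisson
germ-fills), is conformally covariant — the hypotheses of route SAWRestrictionRigidity's R* plus the
Poisson structure, hence a weaker statement than R*;
 (L) LimitExists and (A) AxiomsOfLimit: the full scaling limit of the critical SAW exists as a
chordal family and inherits restriction, Markov, reversal, lattice similarities, conjugation and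
simplicity from exact lattice identities (items shared verbatim with route SAWRestrictionRigidity).
Then BanksOfLimit (support: PB passes to the limit family by portmanteau), PR and the
Lawler–Schramm–Werner fact LSWSimpleRestrictionIsSLE (conformal covariance + restriction + simple ⟹
chordal SLE_8/3, κ = 8/3 only, no fact hypotheses: existence of the SLE_8/3 curve and uniqueness of
its law are PROVED in the tree) give SAWScalingLimit; the assembly is proved sorry-free in the
planner's Sketch.lean.
Lean: `(∀ (D : Literature.Probability.RandomPlanarGeometry.DobrushinDomain) (a b : ℝ →
Literature.Probability.LatticeModels.Site 2),
Literature.Probability.RandomPlanarGeometry.SAW.IsEndpointApprox D a b → ∀ (j : Fin 2) (B :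
Literature.Probability.RandomPlanarGeometry.DobrushinDomain) (n : ℕ) (F : Fin (n + 1) →
Literature.Probability.RandomPlanarGeometry.DobrushinDomain), (B.carrier ⊆ D.carrier ∧ B.pt 0 = D.pt
0 ∧ B.pt 1 = D.pt 1 ∧ D.arc j ⊆ frontier B.carrier ∧ (∃ ε : ℝ, 0 < ε ∧ B.carrier ∩ Metric.ball (D.pt
0) ε = D.carrier ∩ Metric.ball (D.pt 0) ε ∧ B.carrier ∩ Metric.ball (D.pt 1) ε = D.carrier ∩
Metric.ball (D.pt 1) ε)) → (∀ i, ((F i).carrier ⊆ D.carrier ∧ (F i).pt 0 = D.pt 0 ∧ (F i).pt 1 =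
D.pt 1 ∧ D.arc j ⊆ frontier (F i).carrier ∧ (∃ ε : ℝ, 0 < ε ∧ (F i).carrier ∩ Metric.ball (D.pt 0) ε
= D.carrier ∩ Metric.ball (D.pt 0) ε ∧ (F i).carrier ∩ Metric.ball (D.pt 1) ε = D.carrier ∩
Metric.ball (D.pt 1) ε))) → ∀ ε : ENNReal, 0 < ε → ∀ᶠ δ in nhdsWithin (0 : ℝ) (Set.Ioi 0), (∏ S ∈
(Finset.univ : Finset (Finset (Fin (n + 1)))).filter (fun S => Odd S.card),
((Literature.Probability.RandomPlanarGeometry.SAW.law D.carrier δ (a δ) (b δ)).map (fun γ =>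
γ.curve)) (Literature.Probability.RandomPlanarGeometry.CurveClass.rangeSubset (closure B.carrier) ∩
⋂ i ∈ S, Literature.Probability.RandomPlanarGeometry.CurveClass.rangeSubset (closure (F
i).carrier))) ≤ (∏ S ∈ (Finset.univ : Finset (Finset (Fin (n + 1)))).filter (fun S => Even S.card),
((Literature.Probability.RandomPlanarGeometry.SAW.law D.carrier δ (a δ) (b δ)).map (fun γ =>
γ.curve)) (Literature.Probability.RandomPlanarGeometry.CurveClass.rangeSubset (closure B.carrier) ∩
⋂ i ∈ S, Literature.Probability.RandomPlanarGeometry.CurveClass.rangeSubset (closure (F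
i).carrier))) + ε) ∧ (∀ P : Literature.Probability.RandomPlanarGeometry.ChordalFamily, P.IsChordal →
P.IsRestriction → (∃ Q : Literature.Probability.RandomPlanarGeometry.DobrushinDomain →
Literature.Probability.RandomPlanarGeometry.CurveClass ℂ → MeasureTheory.Measure
(Literature.Probability.RandomPlanarGeometry.CurveClass ℂ), P.IsMarkovExtension Q ∧ ∀ (D :
Literature.Probability.RandomPlanarGeometry.DobrushinDomain) (p :
Literature.Probability.RandomPlanarGeometry.CurveClass ℂ) (D' :
Literature.Probability.RandomPlanarGeometry.DobrushinDomain), D'.carrier ⊆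
Literature.Probability.RandomPlanarGeometry.remainingDomain D p → D'.pt 0 = p.target → D'.pt 1 =
D.pt 1 → ∀ T : Set (Literature.Probability.RandomPlanarGeometry.CurveClass ℂ), MeasurableSet T → P
D' T * Q D p (Literature.Probability.RandomPlanarGeometry.CurveClass.rangeSubset (closure
D'.carrier)) = Q D p (T ∩ Literature.Probability.RandomPlanarGeometry.CurveClass.rangeSubset
(closure D'.carrier))) → (∀ D D' : Literature.Probability.RandomPlanarGeometry.DobrushinDomain,
D'.carrier = D.carrier → D'.pt 0 = D.pt 1 → D'.pt 1 = D.pt 0 → P D' = (P D).map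
Literature.Probability.RandomPlanarGeometry.CurveClass.reverse) → (∀ (D :
Literature.Probability.RandomPlanarGeometry.DobrushinDomain) (c : ℂ) (hc : c ≠ 0) (w : ℂ), (∃ (r :
ℝ) (k : ℕ), 0 < r ∧ c = (r : ℂ) * Complex.I ^ k) → P (D.map
(Literature.Probability.RandomPlanarGeometry.similarity c hc w)) = (P D).map
(Literature.Probability.RandomPlanarGeometry.CurveClass.map
(Literature.Probability.RandomPlanarGeometry.similarity c hc w : C(ℂ, ℂ)))) → (∀ D :
Literature.Probability.RandomPlanarGeometry.DobrushinDomain, P (D.map Complex.conjLIE.toHomeomorph)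
= (P D).map (Literature.Probability.RandomPlanarGeometry.CurveClass.map
(Complex.conjLIE.toHomeomorph : C(ℂ, ℂ)))) → (∀ D :
Literature.Probability.RandomPlanarGeometry.DobrushinDomain, ∀ᵐ γ ∂(P D), γ ∈
Literature.Probability.RandomPlanarGeometry.CurveClass.simple ∧ γ.range ∩ frontier D.carrier ⊆ {D.pt
0, D.pt 1}) → (∀ (D : Literature.Probability.RandomPlanarGeometry.DobrushinDomain), ∀ (j : Fin 2) (B
: Literature.Probability.RandomPlanarGeometry.DobrushinDomain) (n : ℕ) (F : Fin (n + 1) →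
Literature.Probability.RandomPlanarGeometry.DobrushinDomain), (B.carrier ⊆ D.carrier ∧ B.pt 0 = D.pt
0 ∧ B.pt 1 = D.pt 1 ∧ D.arc j ⊆ frontier B.carrier ∧ (∃ ε : ℝ, 0 < ε ∧ B.carrier ∩ Metric.ball (D.pt
0) ε = D.carrier ∩ Metric.ball (D.pt 0) ε ∧ B.carrier ∩ Metric.ball (D.pt 1) ε = D.carrier ∩
Metric.ball (D.pt 1) ε)) → (∀ i, ((F i).carrier ⊆ D.carrier ∧ (F i).pt 0 = D.pt 0 ∧ (F i).pt 1 =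
D.pt 1 ∧ D.arc j ⊆ frontier (F i).carrier ∧ (∃ ε : ℝ, 0 < ε ∧ (F i).carrier ∩ Metric.ball (D.pt 0) ε
= D.carrier ∩ Metric.ball (D.pt 0) ε ∧ (F i).carrier ∩ Metric.ball (D.pt 1) ε = D.carrier ∩
Metric.ball (D.pt 1) ε))) → (∏ S ∈ (Finset.univ : Finset (Finset (Fin (n + 1)))).filter (fun S =>
Odd S.card), P D (Literature.Probability.RandomPlanarGeometry.CurveClass.rangeSubset (closure
B.carrier) ∩ ⋂ i ∈ S, Literature.Probability.RandomPlanarGeometry.CurveClass.rangeSubset (closure (F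
i).carrier))) ≤ (∏ S ∈ (Finset.univ : Finset (Finset (Fin (n + 1)))).filter (fun S => Even S.card),
P D (Literature.Probability.RandomPlanarGeometry.CurveClass.rangeSubset (closure B.carrier) ∩ ⋂ i ∈
S, Literature.Probability.RandomPlanarGeometry.CurveClass.rangeSubset (closure (F i).carrier)))) →
P.IsConformallyCovariant) ∧ (∃ P : Literature.Probability.RandomPlanarGeometry.ChordalFamily,
P.IsChordal ∧ (∀ (D : Literature.Probability.RandomPlanarGeometry.DobrushinDomain) (a b : ℝ →
Literature.Probability.LatticeModels.Site 2),
Literature.Probability.RandomPlanarGeometry.SAW.IsEndpointApprox D a b →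
Literature.Probability.RandomPlanarGeometry.TendstoLaw (fun δ (γ :
Literature.Probability.RandomPlanarGeometry.SAW.DomainSAW D.carrier δ (a δ) (b δ)) => γ.curve) (fun
δ => Literature.Probability.RandomPlanarGeometry.SAW.law D.carrier δ (a δ) (b δ)) id (P D))) ∧ (∀ P
: Literature.Probability.RandomPlanarGeometry.ChordalFamily, P.IsChordal → (∀ (D :
Literature.Probability.RandomPlanarGeometry.DobrushinDomain) (a b : ℝ →
Literature.Probability.LatticeModels.Site 2),
Literature.Probability.RandomPlanarGeometry.SAW.IsEndpointApprox D a b →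
Literature.Probability.RandomPlanarGeometry.TendstoLaw (fun δ (γ :
Literature.Probability.RandomPlanarGeometry.SAW.DomainSAW D.carrier δ (a δ) (b δ)) => γ.curve) (fun
δ => Literature.Probability.RandomPlanarGeometry.SAW.law D.carrier δ (a δ) (b δ)) id (P D)) →
P.IsRestriction ∧ (∃ Q : Literature.Probability.RandomPlanarGeometry.DobrushinDomain →
Literature.Probability.RandomPlanarGeometry.CurveClass ℂ → MeasureTheory.Measure
(Literature.Probability.RandomPlanarGeometry.CurveClass ℂ), P.IsMarkovExtension Q ∧ ∀ (D :
Literature.Probability.RandomPlanarGeometry.DobrushinDomain) (p :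
Literature.Probability.RandomPlanarGeometry.CurveClass ℂ) (D' :
Literature.Probability.RandomPlanarGeometry.DobrushinDomain), D'.carrier ⊆
Literature.Probability.RandomPlanarGeometry.remainingDomain D p → D'.pt 0 = p.target → D'.pt 1 =
D.pt 1 → ∀ T : Set (Literature.Probability.RandomPlanarGeometry.CurveClass ℂ), MeasurableSet T → P
D' T * Q D p (Literature.Probability.RandomPlanarGeometry.CurveClass.rangeSubset (closure
D'.carrier)) = Q D p (T ∩ Literature.Probability.RandomPlanarGeometry.CurveClass.rangeSubset
(closure D'.carrier))) ∧ (∀ D D' : Literature.Probability.RandomPlanarGeometry.DobrushinDomain,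
D'.carrier = D.carrier → D'.pt 0 = D.pt 1 → D'.pt 1 = D.pt 0 → P D' = (P D).map
Literature.Probability.RandomPlanarGeometry.CurveClass.reverse) ∧ (∀ (D :
Literature.Probability.RandomPlanarGeometry.DobrushinDomain) (c : ℂ) (hc : c ≠ 0) (w : ℂ), (∃ (r :
ℝ) (k : ℕ), 0 < r ∧ c = (r : ℂ) * Complex.I ^ k) → P (D.map
(Literature.Probability.RandomPlanarGeometry.similarity c hc w)) = (P D).map
(Literature.Probability.RandomPlanarGeometry.CurveClass.map
(Literature.Probability.RandomPlanarGeometry.similarity c hc w : C(ℂ, ℂ)))) ∧ (∀ D :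
Literature.Probability.RandomPlanarGeometry.DobrushinDomain, P (D.map Complex.conjLIE.toHomeomorph)
= (P D).map (Literature.Probability.RandomPlanarGeometry.CurveClass.map
(Complex.conjLIE.toHomeomorph : C(ℂ, ℂ)))) ∧ (∀ D :
Literature.Probability.RandomPlanarGeometry.DobrushinDomain, ∀ᵐ γ ∂(P D), γ ∈
Literature.Probability.RandomPlanarGeometry.CurveClass.simple ∧ γ.range ∩ frontier D.carrier ⊆ {D.pt
0, D.pt 1}))`

## Assembly
Plumbing, proved sorry-free in the planner's Sketch.lean (theorem assembly_proof; axioms propext,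
Classical.choice, Quot.sound): take P from LimitExists; AxiomsOfLimit gives restriction, Markov
extension, reversal, similarity and conjugation covariance, simplicity; BanksOfLimit applied to
PoissonianBanks gives the alternation tower of P on both sides; PoissonRigidity gives
P.IsConformallyCovariant; LSWSimpleRestrictionIsSLE gives IsSLELaw (8/3) D (P D) = law of an SLE_8/3
curve Γ in every D; integral_map turns TendstoLaw … id (P D) into TendstoLaw … Γ preWienerMeasure,
and SAW.aemeasurable_curve supplies the measurability clause of ConvergesInLawToSLE.

Rationale: WHY THIS LINE. Werner2005ConformalRestriction (§4.3 Thm 8, §4.4) constructs every one-sided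
restriction measure as the fill of a POISSON cloud of Brownian excursions hanging off one boundary
arc (intensity (5/8)·μ^exc at SLE_8/3), so −log P[γ avoids A] is the hitting capacity of a σ-finite
measure and the left fill of SLE_8/3 is union-infinitely-divisible; Matheron's theorem
(Molchanov2017 Ch. 4 Def 1.1/Thm 1.6; Kendall, Norberg) says this is EQUIVALENT to complete
alternation of −log(avoidance), an infinite tower of inequalities whose order 2 is the same-side
positive association of route SAWLeftRightFKG (U-infinite-divisibility ⟹ association:
Karłowska-Pik–Schreiber zbl:1158.60002) and whose every order is a necessary consequence of the
conjunct. The line imports random-closed-set theory / Poisson point processes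
(Matheron–Kendall–Molchanov, LastPenrose2017) and conformal-restriction technology
(LawlerSchrammWerner2003Restriction, Virag2003, Lawler2005) into the SAW problem, whose lattice side
has exact restriction (LawlerSchrammWerner2004SAW §3.4.5) but "no FKG, no Markov property"
(MadrasSlade1993): PB asks only that a structure present at δ = 0 be approached in INEQUALITIES,
which cutting/unfolding/pattern technology can produce, and it linearises the identification problem
— each subsequential limit's bank is ONE σ-finite generator ν_D with restriction = Poisson thinning,
so the rigidity conjecture R* of route SAWRestrictionRigidity is needed only under the extra Poisson
hypothesis (PR). What prior routes do not do: SAWLeftRightFKG uses order 2 for tightness;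
SAWRestrictionRigidity assumes no bank structure; SAWConfRestriction/SAWParafermion put conformal
covariance or an observable in the crux; the negatives index (all-δ tightness stmt-0772) is avoided
since every lattice statement here is eventual in δ and per domain.

RANKED CRUXES. #2 PoissonianBanks (crux) — card item r2 (PB): for every Dobrushin domain D, endpoint
approximation (a_δ, b_δ), side j ∈ Fin 2, base sub-domain B and hull-complements F₀, …, F_n of D on
side j (carrier ⊆ D.carrier, same marked points, D.arc j ⊆ frontier, agreement with D in small balls
at a and b), and every ε > 0, eventually as δ → 0⁺: Π over odd-cardinality S ⊆ Fin (n+1) of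
law_δ(curve ⊆ cl B ∩ ⋂_(i∈S) cl F_i) ≤ Π over even-cardinality S of the same + ε (n+1 = 1:
monotonicity, trivial; n+1 = 2: same-side positive association of avoidance events; general:
order-(n+1) alternation of −log q_δ, i.e. asymptotic union-infinite-divisibility of the one-sided
fill). [difficulty: XL] (why it might fail: exact alternation is false at finite δ (lattice banks
are not union-divisible) and only order 2 has a lattice mechanism (envelope FKG, itself open on ℤ²);
a third-order defect for three boundary bumps that does not vanish as δ → 0 refutes it while
association survives.) [Molchanov2017, Werner2005ConformalRestriction, LawlerSchrammWerner2004SAW,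
MadrasSlade1993, DuminilCopinKozmaYadin2014, zbl:1158.60002]
#3 PoissonRigidity (crux) — card item r4 (excursion-measure rigidity) in curve form: every chordal
family P with P.IsChordal, P.IsRestriction, a restriction-coupled Markov extension (verbatim the
clause of SAWRestrictionRigidity.Rigidity), reversibility, covariance under z ↦ r·i^k·z + w (r > 0,
k ∈ ℕ) and complex conjugation, carried by simple curves meeting ∂D only at a, b, and whose banks on
BOTH sides satisfy the exact alternation tower in every Dobrushin domain (Π_(|S| odd) P D(E_B ∩ E_S)
≤ Π_(|S| even) P D(E_B ∩ E_S) for all sides j, bases B and hull-complement families F), is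
conformally covariant (ChordalFamily.IsConformallyCovariant). Logically weaker than
SAWRestrictionRigidity.Rigidity (same conclusion, one more hypothesis); the bet is that the σ-finite
generators (restriction = Poisson thinning; two-sidedness = a self-consistency of ONE measure under
swallowing) make the symmetry upgrade attackable, the conformal answer being ν = (5/8)·μ^(Brownian
excursion) by Werner's theorem. [difficulty: open-problem] (why it might fail: a symmetry-upgrade
conjecture like R*: an anisotropic family with exact restriction, Markov, D4 + dilations and Poisson
banks on both sides (e.g. fills of a non-conformal, scale- and translation-invariant
two-sided-consistent germ measure) would refute it; none is known, none is excluded.)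
[LawlerSchrammWerner2003Restriction, Werner2005ConformalRestriction, Beffara2008Universal,
Virag2003, Lawler2005]
#4 AxiomsOfLimit (crux) — shared verbatim with route SAWRestrictionRigidity
(stmt-CriticalPhenomena-1370): every chordal family P that is the full scaling limit of the critical
δℤ² SAW laws (every Dobrushin domain, every endpoint approximation) has two-sided restriction, a
restriction-coupled Markov extension, reversibility, covariance under z ↦ r·i^k·z + w and
conjugation, and is carried by simple boundary-avoiding curves — exact lattice identities passed to
the limit. [deps: LimitExists] [difficulty: L] (why it might fail: Markov passage needs stability of
SAW limits in slit domains perturbed near the tip; simplicity and boundary avoidance need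
no-crawling estimates not in print; restriction passage needs null touching of hull boundaries;
largest-component bookkeeping of Ω_δ.) [LawlerSchrammWerner2004SAW, Werner2007, KennedyLawler2013,
DuminilCopinHammond2013]
#5 LimitExists (crux) — shared verbatim with route SAWRestrictionRigidity
(stmt-CriticalPhenomena-1371): the critical δℤ² SAW laws have a full scaling limit as a chordal
curve family — ∃ P chordal with TendstoLaw to P D for every Dobrushin domain and every endpoint
approximation (the limit is NOT identified here). [difficulty: XL] (why it might fail: eventual
tightness of the critical SAW is open (no annulus-crossing bound at x_c); uniqueness of
subsequential limits needs an extra scalar input (avoidance-cocycle convergence); an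
approximation-dependent limit would refute the conjunct itself as typed.)
[LawlerSchrammWerner2004SAW, KemppainenSmirnov2017, AizenmanBurchardDuke1999,
DuminilCopinHammond2013, KennedyLawler2013]
#9 BanksOfLimit (support) — passage to the limit (card item r5): PoissonianBanks implies that every
chordal family arising as the full scaling limit of the critical SAW laws satisfies the exact
alternation tower on both sides in every Dobrushin domain — finite products of probabilities of the
closed events {range ⊆ cl B ∩ ⋂ cl F_i} converge by portmanteau once the limit gives zero mass to
curves touching a hull boundary without entering (the same null-touching lemma as the restriction
passage inside AxiomsOfLimit). [difficulty: M] [BillingsleyCPM1999, LawlerSchrammWerner2004SAW,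
Molchanov2017]
#9 LSWSimpleRestrictionIsSLE (support) — Lawler–Schramm–Werner (arXiv:math/0209343 p. 5 results 1–2,
Prop. 3.3, Thm 6.1, Cor. 8.6) transposed to Dobrushin domains at κ = 8/3 with NO fact hypotheses: a
chordal family that is conformally covariant, has the two-sided restriction property and is carried
by simple curves meeting ∂D only at the marked points is, in every domain, the chordal SLE_8/3 law
(IsSLELaw (8/3)). Existence of the SLE_8/3 curve (exists_isSLECurve_eightThirds) and uniqueness of
its law (IsSLECurve.map_eq_holds) are proved in the tree, so unlike stmt-CriticalPhenomena-0775 no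
`exists_isSLECurve` (SLE₈) hypothesis is carried; boundary avoidance in every sub-domain turns the
closure-form conditioning into LSW's K ∩ A = ∅ form up to null sets. [difficulty: L]
[LawlerSchrammWerner2003Restriction, RohdeSchramm2005, Lawler2005]
#9 MutualAvoidanceLaw (support) — the card's quantitative order-2 shadow PB₂ in conformal form (not
used by the assembly; filed as the route's typed falsifier and as the bridge to the 5/8-law cards):
for two hull-complements F₁, F₂ of D on the same side, the SAW log-covariance ratio q_δ(E₁ ∩
E₂)/(q_δ(E₁)·q_δ(E₂)) converges as δ → 0⁺ to the same ratio under the chordal SLE_8/3 law of D — by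
Werner's theorem the exponential of (5/8)·(mutual Brownian-excursion mass of the two hulls),
computable on the lattice as (5/8)·c₀⁻¹·(mutual random-walk-excursion mass) with no conformal map.
[difficulty: XL] [Werner2005ConformalRestriction, LawlerSchrammWerner2004SAW, KennedyLawler2013,
arXiv:1008.4321]

TWO-LAYER PLAN. Foreseen glued splits (none filed now; k ≤ 3, depth 1): PoissonianBanks ⇐
Order2Association (same-side FKG of avoidance events, = the ℤ² companion of
SAWLeftRightFKG.LeftRightFKG restricted to hull events) → HigherOrderFromOrder2 (orders ≥ 3 from
order 2 in all slit sub-domains + exact restriction: the based tower is the base-free tower of the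
sub-domain) → PoissonianBanks; PoissonRigidity ⇐ GeneratorForm (restriction + alternation ⇒ ∃
σ-finite thinning-compatible generators ν_D on hulls hanging off one arc, Choquet–Matheron on the
hull semilattice) → GeneratorRigidity (two-sided consistency + dilations/translations/D4 ⇒ ν =
c·L_*μ^(Brownian excursion), quarter-turn ⇒ L conformal) → PoissonRigidity; LimitExists ⇐
EventualTight ∧ simple subsequential limits → uniqueness of subsequential limits → LimitExists (as
planned in SAWRestrictionRigidity, shared).

KILL CRITERIA. ¬PoissonianBanks by a certified lattice/transfer-matrix witness at some order ≥ 3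
that persists as δ → 0 closes the route `refuted:PoissonianBanks` (and records that the SAW bank is
not Poissonian in the limit — which would contradict SAWScalingLimit + null touching, so such a
witness is major evidence against the conjunct as typed, to be handed to the negatives index); a
witness at order 2 also kills SAWLeftRightFKG's hull-event association. ¬PoissonRigidity by an
explicit anisotropic restriction–Markov–Poisson family with all lattice symmetries closes the route
refuted and is a new barrier (it also refutes SAWRestrictionRigidity.Rigidity).
¬LimitExists/¬AxiomsOfLimit through approximation dependence refutes the conjunct, not just this
route. Rigidity (R*) proved in SAWRestrictionRigidity makes PoissonRigidity a corollary and this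
route's remaining content is PoissonianBanks as a structural theorem (close `superseded` if
LimitExists/AxiomsOfLimit also close there first).

NOT DECOMPOSED YET. The generator form of the banks (Choquet–Matheron theorem on the semilattice of
hulls attached to an arc; uniqueness of the Lévy measure), the null-touching lemma, the order-2 case
as a separate item (it is SAWLeftRightFKG's business on events of left–right type; here only
hull-avoidance events occur), uniform-in-family versions of PB (not needed for the assembly), the
random-walk form of MutualAvoidanceLaw (needs the discrete excursion measure, definition request),
and everything inside LimitExists (tenure of SAWRestrictionRigidity).

CHEAPEST FALSIFIER. Transfer-matrix evaluation (the tree has SAWStripTM*) of the three-bump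
alternation defect at x_c(ℤ²) ∈ [1/2.7, 1/2.6] in strips 8–12 wide with three disjoint boundary
bumps on one side: q₀q₁q₂·q₀₁₂ ≤ q₀₁q₀₂q₁₂ must hold up to a defect decreasing with bump
size/separation; a defect stable under refinement kills PoissonianBanks at order 3 while leaving
association alive. The card's exact enumeration (orders 2–4, 4×4 and 5×4 boxes, zero violations at x
≤ 0.45, violations at x ≥ 0.6) is the only data so far; no kit job was run in this plancard session
(hub compute-free, one-shot).

NUMBERS. x_c = 1/μ(ℤ²), μ ∈ [2.6, 2.7] (LawlerSchrammWerner2004SAW §3.1; tree fact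
connectiveConstant_bounds); restriction exponent 5/8 and ρ(5/8) = 0 (Werner2005ConformalRestriction
Thm 12: α = (3ρ+10)(2+ρ)/32); one-sided restriction measures exist for every α > 0 and are Poisson
excursion fills with intensity ∝ α (Thm 8, Cor. 6); two-sided ones iff α ≥ 5/8, simple only at 5/8
(LawlerSchrammWerner2003Restriction p. 5). Card numerics: alternation orders 2, 3, 4 hold with 0
violations on 3×3, 4×4 (8 512 chords), 5×4 (79 384 chords) boxes at x ∈ {0.30, 0.379, 0.45}, fail at
x = 0.6 (3/21, 5/35, 10/35) and x = 1. Items at open: 8 (4 cruxes, 3 supports, 1 assembly).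

DEFINITION REQUESTS. (1) `IsHullComplement D j D'` (Literature/Probability/RandomPlanarGeometry):
the inlined five-clause condition "D' ⊆ D Dobrushin sub-domain with the same marked points, D.arc j
⊆ frontier D'.carrier, agreeing with D in balls at both marked points" — would shrink
PoissonianBanks/PoissonRigidity/BanksOfLimit/MutualAvoidanceLaw signatures. (2)
`SAW.discreteExcursionMeasure Ω δ (arc)` (random-walk excursion measure of Ω_δ from and to a
boundary arc, Kozdron–Lawler normalisation) for the lattice-native form of MutualAvoidanceLaw and
the 5/8-law cards. (3) cite fact wanted: Werner2005ConformalRestriction Thm 8 / Lawler2005 Prop.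
9.13 in the tree's language — the tree already has the construction
(`isRightRestrictionMeasure_map_cloudConfig`, OneSidedExcursionCloudMeasure) for clouds of hung
restriction samples; the identification "left fill of chordal SLE_8/3 = P⁺_(5/8)" is
`sleTrace_eightThirds_isRestrictionMeasure_map` territory. Filed after open with `ledger workitem
add --kind definition`.

Novelty: Searches (2026-08-15): `lit frontier CriticalPhenomena --since 2020` (30 rows; arXiv:2605.04395
"Anchored random clusters and SLE excursions" the only excursion item, no SAW/random-set
divisibility); `lit bridges CriticalPhenomena --cross any` (30, none relevant); `lit search --hybrid
"union infinitely divisible random closed set Poisson completely alternating capacity Matheron"` (12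
held: Molchanov2017 pp. 262–264 read, LastPenrose2017 p. 157, Kallenberg2021); `lit search --source
zbmath "union infinitely divisible random closed set"` (4: Molchanov 1992 union-stable, Norberg
1989, Mase 1979, Karłowska-Pik–Schreiber 2008 zbl:1158.60002 association criteria); `lit search
--source crossref "self-avoiding walk union infinitely divisible Poisson restriction SLE"` (10, all
off-topic); `lit read paper:arxiv-math-0307353 --grep Poisson` (Thm 8 p. 24, §4.4, Thm 12 read);
openalex/s2 rate-limited and `lit galaxy search … --star all` saturated this session (recorded; the
card's own searches and the refuter novelty audit of 2026-08-15T05:49Z, grade new-combination,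
stand).
Nearest prior art found: Werner2005ConformalRestriction (arXiv:math/0307353 §4.3 Thm 8, §4.4:
one-sided restriction measures = right boundaries of Poisson clouds of Brownian excursions,
union-additive in the exponent — the continuum PB verbatim); Molchanov2017 Ch. 4 Thm 1.6 (Matheron:
union-infinite-divisibility ⟺ T = 1 − exp(−Ψ), Ψ completely alternating); LawlerSchrammWerner2004SAW
§3.4.5 (exact lattice restriction  [refs: 2605.04395, math/0307353, paper:arxiv-math-0307353, Molchanov2017, LastPenrose2017, Kallenberg2021]

Barriers (technique_class: poisson-germ-divisibility, restriction-markov-rigidity): - technique_class: poisson-germ-divisibility, restriction-markov-rigidity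
- Literature.Barriers.CriticalPhenomena.SupercriticalSAWSpaceFilling: consistent — every lattice
statement is at x = x_c (SAW.law is the critical law by definition) and eventual in δ; the card's
numerics show the tower failing for x ≥ 0.6, as space-filling demands; nothing is claimed open in x.
- Literature.Barriers.CriticalPhenomena.EmbeddingModulusUniqueness: respected exactly as in
SAWRestrictionRigidity — PoissonRigidity is NOT embedding-blind: its hypothesis contains covariance
under the Euclidean quarter-turn (k odd in z ↦ r·i^k·z + w), the datum that pins Beffara's linear
modulus; on a sheared lattice the expected conclusion is L_*SLE_8/3 with generator L_*μ^exc.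
- Literature.Barriers.CriticalPhenomena.ScaleCovarianceNotMoebius: PoissonRigidity is a
symmetry-upgrade statement and could fail the same way; it falls outside the barrier's class (d = 3
correlation families with Euclidean + scale data only) because it carries two-sided restriction,
restriction-coupled Markov, reversibility AND two-sided Poisson bank structure — the honest bet,
recorded as the first kill criterion.
- Literature.Barriers.CriticalPhenomena.NienhuisWeightsExcludeVertexSAW: evaded trivially — no
parafermionic observable, no local linear relation; only avoidance probabilities and their
inequalities.
- Literature.Barriers.CriticalPhenomena.SAWNotKineticallyGrown: only the configurational x_c-measure
and its exact conditioning

Novelty grade: new-combination — ROUTE REVIEW (refuter 71855780-0, 2026-08-15 ~14:00Z): KEEP OPEN, no blocking objection. New combination (concur with the card audit of 05:49Z, on my own reading of Werner 2005 pp.20–24): Werner's Poisson-excursion representation + Matheron's alternation criterion transported to lattice SAW hull-avo (refuter refuter-rreview-route-CriticalPhenomena--71855780-0, 2026-08-15T13:59:51Z; prior: arXiv:math/0307353 (Werner 2005) Thm 8 + §4.4: SLE8/3 right boundary = Poisson cloud of excursions (continuum PB exact), Molchanov2017 Ch.4 Thm 1.6 (Matheron: U-inf-divisible <=> completely alternating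 -log avoidance), arXiv:math/0209343 (LSW03) p.5, Prop 3.3, Thm 6.1, Cor 8.6 (tree: LawlerSchrammWerner2003_holds), arXiv:math/0204277 (LSW04) §3.4.5 exact lattice restriction, zbl:1158.60002 (U-inf-)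

sub-problem: SAWScalingLimit · status: open · opened planner-plancard-CriticalPhenomena-SAWScaling-25882b7e-0 2026-08-15T11:35:02Z · rev 2 · ledger route-CriticalPhenomena-SAWPoissonBanks
GENERATED by the gate from the ledger (D-0016/17). Provers cite these decls: `theorem foo : Summit.CriticalPhenomena.SAWScalingLimit.Theses.SAWPoissonBanks.<Decl> := …` in Summits/CriticalPhenomena/SAWScalingLimit/Theorems/<Name>.lean.
-/

namespace Summit.CriticalPhenomena.SAWScalingLimit.Theses.SAWPoissonBanks

open scoped BigOperators Topology Manifold Classical MeasureTheory ProbabilityTheory Matrix InnerProductSpace ComplexConjugate ContinuousMap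
open Filter Set Function TopologicalSpace MeasureTheory

attribute [summit_statement] _root_.SAWScalingLimit

/-- item stmt-CriticalPhenomena-4776 · crux · rank 2 · open · by planner
why it might fail: exact alternation is false at finite δ (lattice banks are not union-divisible) and only order 2 has a lattice mechanism (envelope FKG, itself open on ℤ²); a third-order defect for three boundary bumps that does not vanish as δ → 0 refutes it while association survives.
sources: Molchanov2017, Werner2005ConformalRestriction, LawlerSchrammWerner2004SAW, MadrasSlade1993, DuminilCopinKozmaYadin2014, zbl:1158.60002
[crux] card item r2 (PB): for every Dobrushin domain D, endpoint approximation (a_δ, b_δ), side j ∈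
Fin 2, base sub-domain B and hull-complements F₀, …, F_n of D on side j (carrier ⊆ D.carrier, same
marked points, D.arc j ⊆ frontier, agreement with D in small balls at a and b), and every ε > 0,
eventually as δ → 0⁺: Π over odd-cardinality S ⊆ Fin (n+1) of law_δ(curve ⊆ cl B ∩ ⋂_(i∈S) cl F_i) ≤
Π over even-cardinality S of the same + ε (n+1 = 1: monotonicity, trivial; n+1 = 2: same-side
positive association of avoidance events; general: order-(n+1) alternation of −log q_δ, i.e.
asymptotic union-infinite-divisibility of the one-sided fill). [difficulty: XL] -/
@[route_item "route-CriticalPhenomena-SAWPoissonBanks", crux]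
def PoissonianBanks : Prop :=
  ∀ (D : Literature.Probability.RandomPlanarGeometry.DobrushinDomain) (a b : ℝ → Literature.Probability.LatticeModels.Site 2), Literature.Probability.RandomPlanarGeometry.SAW.IsEndpointApprox D a b → ∀ (j : Fin 2) (B : Literature.Probability.RandomPlanarGeometry.DobrushinDomain) (n : ℕ) (F : Fin (n + 1) → Literature.Probability.RandomPlanarGeometry.DobrushinDomain), (B.carrier ⊆ D.carrier ∧ B.pt 0 = D.pt 0 ∧ B.pt 1 = D.pt 1 ∧ D.arc j ⊆ frontier B.carrier ∧ (∃ ε : ℝ, 0 < ε ∧ B.carrier ∩ Metric.ball (D.pt 0) ε = D.carrier ∩ Metric.ball (D.pt 0) ε ∧ B.carrier ∩ Metric.ball (D.pt 1) ε = D.carrier ∩ Metric.ball (D.pt 1) ε)) → (∀ i, ((F i).carrier ⊆ D.carrier ∧ (F i).pt 0 = D.pt 0 ∧ (F i).pt 1 = D.pt 1 ∧ D.arc j ⊆ frontier (F i).carrier ∧ (∃ ε : ℝ, 0 < ε ∧ (F i).carrier ∩ Metric.ball (D.pt 0) ε = D.carrier ∩ Metric.ball (D.pt 0) ε ∧ (F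 i).carrier ∩ Metric.ball (D.pt 1) ε = D.carrier ∩ Metric.ball (D.pt 1) ε))) → ∀ ε : ENNReal, 0 < ε → ∀ᶠ δ in nhdsWithin (0 : ℝ) (Set.Ioi 0), (∏ S ∈ (Finset.univ : Finset (Finset (Fin (n + 1)))).filter (fun S => Odd S.card), ((Literature.Probability.RandomPlanarGeometry.SAW.law D.carrier δ (a δ) (b δ)).map (fun γ => γ.curve)) (Literature.Probability.RandomPlanarGeometry.CurveClass.rangeSubset (closure B.carrier) ∩ ⋂ i ∈ S, Literature.Probability.RandomPlanarGeometry.CurveClass.rangeSubset (closure (F i).carrier))) ≤ (∏ S ∈ (Finset.univ : Finset (Finset (Fin (n + 1)))).filter (fun S => Even S.card), ((Literature.Probability.RandomPlanarGeometry.SAW.law D.carrier δ (a δ) (b δ)).map (fun γ => γ.curve)) (Literature.Probability.RandomPlanarGeometry.CurveClass.rangeSubset (closure B.carrier) ∩ ⋂ i ∈ S, Literature.Probability.RandomPlanarGeometry.CurveClass.rangeSubset (closure (F i).carrier))) + ε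

/-- item stmt-CriticalPhenomena-4777 · crux · rank 3 · open · by planner
why it might fail: a symmetry-upgrade conjecture like R*: an anisotropic family with exact restriction, Markov, D4 + dilations and Poisson banks on both sides (e.g. fills of a non-conformal, scale- and translation-invariant two-sided-consistent germ measure) would refute it; none is known, none is excluded.
sources: LawlerSchrammWerner2003Restriction, Werner2005ConformalRestriction, Beffara2008Universal, Virag2003, Lawler2005
[crux] card item r4 (excursion-measure rigidity) in curve form: every chordal family P with
P.IsChordal, P.IsRestriction, a restriction-coupled Markov extension (verbatim the clause of
SAWRestrictionRigidity.Rigidity), reversibility, covariance under z ↦ r·i^k·z + w (r > 0, k ∈ ℕ) and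
complex conjugation, carried by simple curves meeting ∂D only at a, b, and whose banks on BOTH sides
satisfy the exact alternation tower in every Dobrushin domain (Π_(|S| odd) P D(E_B ∩ E_S) ≤ Π_(|S|
even) P D(E_B ∩ E_S) for all sides j, bases B and hull-complement families F), is conformally
covariant (ChordalFamily.IsConformallyCovariant). Logically weaker than
SAWRestrictionRigidity.Rigidity (same conclusion, one more hypothesis); the bet is that the σ-finite
generators (restriction = Poisson thinning; two-sidedness = a self-consistency of ONE measure under
swallowing) make the symmetry upgrade attackable, the conformal answer being ν = (5/8)·μ^(Brownian
excursion) by Werner's theorem. [difficulty: open-problem] -/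
@[route_item "route-CriticalPhenomena-SAWPoissonBanks", crux]
def PoissonRigidity : Prop :=
  ∀ P : Literature.Probability.RandomPlanarGeometry.ChordalFamily, P.IsChordal → P.IsRestriction → (∃ Q : Literature.Probability.RandomPlanarGeometry.DobrushinDomain → Literature.Probability.RandomPlanarGeometry.CurveClass ℂ → MeasureTheory.Measure (Literature.Probability.RandomPlanarGeometry.CurveClass ℂ), P.IsMarkovExtension Q ∧ ∀ (D : Literature.Probability.RandomPlanarGeometry.DobrushinDomain) (p : Literature.Probability.RandomPlanarGeometry.CurveClass ℂ) (D' : Literature.Probability.RandomPlanarGeometry.DobrushinDomain), D'.carrier ⊆ Literature.Probability.RandomPlanarGeometry.remainingDomain D p → D'.pt 0 = p.target → D'.pt 1 = D.pt 1 → ∀ T : Set (Literature.Probability.RandomPlanarGeometry.CurveClass ℂ), MeasurableSet T → P D' T * Q D p (Literature.Probability.RandomPlanarGeometry.CurveClass.rangeSubset (closure D'.carrier)) = Q D p (T ∩ Literature.Probability.RandomPlanarGeometry.CurveClass.rangeSubset (closure D'.carrier))) → (∀ D D' : Literature.Probability.RandomPlanarGeometry.DobrushinDomain, D'.carrier = D.carrier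 → D'.pt 0 = D.pt 1 → D'.pt 1 = D.pt 0 → P D' = (P D).map Literature.Probability.RandomPlanarGeometry.CurveClass.reverse) → (∀ (D : Literature.Probability.RandomPlanarGeometry.DobrushinDomain) (c : ℂ) (hc : c ≠ 0) (w : ℂ), (∃ (r : ℝ) (k : ℕ), 0 < r ∧ c = (r : ℂ) * Complex.I ^ k) → P (D.map (Literature.Probability.RandomPlanarGeometry.similarity c hc w)) = (P D).map (Literature.Probability.RandomPlanarGeometry.CurveClass.map (Literature.Probability.RandomPlanarGeometry.similarity c hc w : C(ℂ, ℂ)))) → (∀ D : Literature.Probability.RandomPlanarGeometry.DobrushinDomain, P (D.map Complex.conjLIE.toHomeomorph) = (P D).map (Literature.Probability.RandomPlanarGeometry.CurveClass.map (Complex.conjLIE.toHomeomorph : C(ℂ, ℂ)))) → (∀ D : Literature.Probability.RandomPlanarGeometry.DobrushinDomain, ∀ᵐ γ ∂(P D), γ ∈ Literature.Probability.RandomPlanarGeometry.CurveClass.simple ∧ γ.range ∩ frontier D.carrier ⊆ {D.pt 0, D.pt 1}) → (∀ (D : Literature.Probability.RandomPlanarGeometry.DobrushinDomain), ∀ (j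 : Fin 2) (B : Literature.Probability.RandomPlanarGeometry.DobrushinDomain) (n : ℕ) (F : Fin (n + 1) → Literature.Probability.RandomPlanarGeometry.DobrushinDomain), (B.carrier ⊆ D.carrier ∧ B.pt 0 = D.pt 0 ∧ B.pt 1 = D.pt 1 ∧ D.arc j ⊆ frontier B.carrier ∧ (∃ ε : ℝ, 0 < ε ∧ B.carrier ∩ Metric.ball (D.pt 0) ε = D.carrier ∩ Metric.ball (D.pt 0) ε ∧ B.carrier ∩ Metric.ball (D.pt 1) ε = D.carrier ∩ Metric.ball (D.pt 1) ε)) → (∀ i, ((F i).carrier ⊆ D.carrier ∧ (F i).pt 0 = D.pt 0 ∧ (F i).pt 1 = D.pt 1 ∧ D.arc j ⊆ frontier (F i).carrier ∧ (∃ ε : ℝ, 0 < ε ∧ (F i).carrier ∩ Metric.ball (D.pt 0) ε = D.carrier ∩ Metric.ball (D.pt 0) ε ∧ (F i).carrier ∩ Metric.ball (D.pt 1) ε = D.carrier ∩ Metric.ball (D.pt 1) ε))) → (∏ S ∈ (Finset.univ : Finset (Finset (Fin (n + 1)))).filter (fun S => Odd S.card), P D (Literature.Probability.RandomPlanarGeometry.CurveClass.rangeSubset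 (closure B.carrier) ∩ ⋂ i ∈ S, Literature.Probability.RandomPlanarGeometry.CurveClass.rangeSubset (closure (F i).carrier))) ≤ (∏ S ∈ (Finset.univ : Finset (Finset (Fin (n + 1)))).filter (fun S => Even S.card), P D (Literature.Probability.RandomPlanarGeometry.CurveClass.rangeSubset (closure B.carrier) ∩ ⋂ i ∈ S, Literature.Probability.RandomPlanarGeometry.CurveClass.rangeSubset (closure (F i).carrier)))) → P.IsConformallyCovariant

/-- item stmt-CriticalPhenomena-1370 · crux · rank 4 · open · by planner
why it might fail: Markov passage needs stability of SAW limits in slit domains perturbed near the tip; simplicity and boundary avoidance need no-crawling estimates not in print; restriction passage needs null touching of hull boundaries; largest-component bookkeeping of Ω_δ.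
sources: LawlerSchrammWerner2004SAW, Werner2007, KennedyLawler2013, DuminilCopinHammond2013
[crux] every chordal family P that is the full scaling limit (lim) of the critical δℤ² SAW laws —
for every Dobrushin domain and EVERY endpoint approximation (SAW.IsEndpointApprox) — satisfies the
hypotheses of Rigidity: restriction (exact lattice identity, LSW04 §3.4.5; portmanteau on the closed
event range ⊆ closure D' plus null touching), restriction-coupled Markov (conditional future given a
lattice past = SAW of the slit graph; its conditioning into a Jordan subdomain = SAW there),
reversibility (exact), covariance under z ↦ r·i^k·z + w and conjugation (quarter-turn/conjugation
exact at each δ; dilations via (λΩ)_δ = λ·Ω_{δ/λ} and the full-filter limit; translations: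
axis-parallel w lies in δ_nℤ² along δ_n = |w|/n, then compose — no continuity in D needed),
simplicity and boundary avoidance. Sources: LawlerSchrammWerner2004SAW (arXiv:math/0204277 §3.4.5,
p.14), Werner2007 §3.2, KennedyLawler2013, DuminilCopinHammond2013. -/
@[route_item "route-CriticalPhenomena-SAWPoissonBanks", crux]
def AxiomsOfLimit : Prop :=
  ∀ P : Literature.Probability.RandomPlanarGeometry.ChordalFamily, P.IsChordal → (∀ (D : Literature.Probability.RandomPlanarGeometry.DobrushinDomain) (a b : ℝ → Literature.Probability.LatticeModels.Site 2), Literature.Probability.RandomPlanarGeometry.SAW.IsEndpointApprox D a b → Literature.Probability.RandomPlanarGeometry.TendstoLaw (fun δ (γ : Literature.Probability.RandomPlanarGeometry.SAW.DomainSAW D.carrier δ (a δ) (b δ)) => γ.curve) (fun δ => Literature.Probability.RandomPlanarGeometry.SAW.law D.carrier δ (a δ) (b δ)) id (P D)) → P.IsRestriction ∧ (∃ Q : Literature.Probability.RandomPlanarGeometry.DobrushinDomain → Literature.Probability.RandomPlanarGeometry.CurveClass ℂ → MeasureTheory.Measure (Literature.Probability.RandomPlanarGeometry.CurveClass ℂ),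 P.IsMarkovExtension Q ∧ ∀ (D : Literature.Probability.RandomPlanarGeometry.DobrushinDomain) (p : Literature.Probability.RandomPlanarGeometry.CurveClass ℂ) (D' : Literature.Probability.RandomPlanarGeometry.DobrushinDomain), D'.carrier ⊆ Literature.Probability.RandomPlanarGeometry.remainingDomain D p → D'.pt 0 = p.target → D'.pt 1 = D.pt 1 → ∀ T : Set (Literature.Probability.RandomPlanarGeometry.CurveClass ℂ), MeasurableSet T → P D' T * Q D p (Literature.Probability.RandomPlanarGeometry.CurveClass.rangeSubset (closure D'.carrier)) = Q D p (T ∩ Literature.Probability.RandomPlanarGeometry.CurveClass.rangeSubset (closure D'.carrier))) ∧ (∀ D D' : Literature.Probability.RandomPlanarGeometry.DobrushinDomain, D'.carrier = D.carrier → D'.pt 0 = D.pt 1 → D'.pt 1 = D.pt 0 → P D' = (P D).map Literature.Probability.RandomPlanarGeometry.CurveClass.reverse) ∧ (∀ (D : Literature.Probability.RandomPlanarGeometry.DobrushinDomain) (c : ℂ) (hc : c ≠ 0) (w : ℂ), (∃ (r : ℝ) (k : ℕ), 0 < r ∧ c = (r : ℂ) * Complex.I ^ k) → P (D.map (Literature.Probability.RandomPlanarGeometry.similarity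 c hc w)) = (P D).map (Literature.Probability.RandomPlanarGeometry.CurveClass.map (Literature.Probability.RandomPlanarGeometry.similarity c hc w : C(ℂ, ℂ)))) ∧ (∀ D : Literature.Probability.RandomPlanarGeometry.DobrushinDomain, P (D.map Complex.conjLIE.toHomeomorph) = (P D).map (Literature.Probability.RandomPlanarGeometry.CurveClass.map (Complex.conjLIE.toHomeomorph : C(ℂ, ℂ)))) ∧ (∀ D : Literature.Probability.RandomPlanarGeometry.DobrushinDomain, ∀ᵐ γ ∂(P D), γ ∈ Literature.Probability.RandomPlanarGeometry.CurveClass.simple ∧ γ.range ∩ frontier D.carrier ⊆ {D.pt 0, D.pt 1})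

/-- item stmt-CriticalPhenomena-1371 · crux · rank 5 · SPLIT (gen 1) into EventualTight, SimpleSubseqLimits, AvoidanceCocycleLimit + glue LimitExistsOfTSC · direct attempts still welcome (low priority) · by planner
why it might fail: eventual tightness of the critical SAW is open (no annulus-crossing bound at x_c); uniqueness of subsequential limits needs an extra scalar input (avoidance-cocycle convergence); an approximation-dependent limit would refute the conjunct itself as typed.
sources: LawlerSchrammWerner2004SAW, KemppainenSmirnov2017, AizenmanBurchardDuke1999, DuminilCopinHammond2013, KennedyLawler2013
[crux] existence of the full scaling limit of the critical δℤ² SAW as a chordal curve family: ∃ P,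
P.IsChordal ∧ (lim) for every Dobrushin domain and every endpoint approximation (the limit is NOT
identified here). Planned glued split (tenure): EventualTight ∧ simple boundary-avoiding
subsequential limits; uniqueness of subsequential limits from AvoidanceCocycleLimit +
AvoidanceDeterminesLaw; diagonal extraction over a countable dense class of domains. Sources:
LawlerSchrammWerner2004SAW (arXiv:math/0204277 p.3 'we do not know how to prove the existence of the
limit'), KemppainenSmirnov2017 (arXiv:1212.6215 Thm 1.5), AizenmanBurchardDuke1999,
DuminilCopinHammond2013 (arXiv:1205.0401). -/
@[route_item "route-CriticalPhenomena-SAWPoissonBanks", crux]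
def LimitExists : Prop :=
  ∃ P : Literature.Probability.RandomPlanarGeometry.ChordalFamily, P.IsChordal ∧ (∀ (D : Literature.Probability.RandomPlanarGeometry.DobrushinDomain) (a b : ℝ → Literature.Probability.LatticeModels.Site 2), Literature.Probability.RandomPlanarGeometry.SAW.IsEndpointApprox D a b → Literature.Probability.RandomPlanarGeometry.TendstoLaw (fun δ (γ : Literature.Probability.RandomPlanarGeometry.SAW.DomainSAW D.carrier δ (a δ) (b δ)) => γ.curve) (fun δ => Literature.Probability.RandomPlanarGeometry.SAW.law D.carrier δ (a δ) (b δ)) id (P D))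

-- parent: LimitExists · child (gen 1)
/--     item stmt-CriticalPhenomena-1372 · crux · rank 501 · open
    parent: LimitExists · by planner
    why it might fail: No annulus-crossing (Aizenman–Burchard / Kemppainen–Smirnov G2) bound is known for the SAW at x_c: sub-ballisticity and endpoint delocalisation control the walk along its length, not k disjoint crossings of a spatial annulus; a domain forcing macroscopic oscillation as δ→0 refutes it.
    sources: KemppainenSmirnov2017, AizenmanBurchardDuke1999, DuminilCopinHammond2013, arXiv:1212.6215, arXiv:1205.0401
[support] eventual tightness of the pushed-forward critical SAW laws: for every Dobrushin domain and
endpoint approximation there is δ₀ > 0 such that {(law D δ a_δ b_δ).map curve : δ ∈ (0, δ₀]} is a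
tight set of measures on CurveClass ℂ — the repaired (∃ δ₀) form of the refuted all-δ statement
stmt-CriticalPhenomena-0772 suggested by its refutation; child-designate of LimitExists, shared need
of every SAW route. Intended tools: Aizenman–Burchard / Kemppainen–Smirnov Condition G2 (an
annulus-crossing bound at x_c not in print). Sources: KemppainenSmirnov2017 Thm 1.5,
AizenmanBurchardDuke1999, DuminilCopinHammond2013. -/
@[route_item "route-CriticalPhenomena-SAWPoissonBanks"]
def EventualTight : Prop :=
  ∀ (D : Literature.Probability.RandomPlanarGeometry.DobrushinDomain) (a b : ℝ → Literature.Probability.LatticeModels.Site 2), Literature.Probability.RandomPlanarGeometry.SAW.IsEndpointApprox D a b → ∃ δ₀ : ℝ, 0 < δ₀ ∧ MeasureTheory.IsTightMeasureSet ((fun δ => (Literature.Probability.RandomPlanarGeometry.SAW.law D.carrier δ (a δ) (b δ)).map (fun γ => γ.curve)) '' Set.Ioc 0 δ₀)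

-- parent: LimitExists · child (gen 1)
/--     item stmt-CriticalPhenomena-4982 · crux · rank 502 · open
    parent: LimitExists · by planner
    why it might fail: Weak limits of simple polylines need not be simple or boundary-avoiding: needs no-macroscopic-self-approach and no-boundary-crawling bounds for the x_c-SAW under EVERY IsEndpointApprox (rough boundary near the pinned endpoints); only sub-ballisticity is in print.
    sources: LawlerSchrammWerner2004SAW, KennedyLawler2013, DuminilCopinHammond2013, arXiv:2310.17299, AizenmanBurchardDuke1999
[crux] (S): for every Dobrushin domain, endpoint approximation, sequence s_n → 0+ and probability
measure ν on CurveClass ℂ that is the weak limit of the pushed-forward SAW laws along s_n, ν-a.e.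
curve class is simple, runs from a = D.pt 0 to b = D.pt 1, has range in closure D and meets ∂D only
at a, b (exactly the carrier clause of AvoidanceDeterminesLaw). Subsequential form of
SAWConfRestriction.SimpleOfLimit (stmt-CriticalPhenomena-0774). Foreseen split: 'range is a simple
boundary-avoiding arc' (follows from AvoidanceLimit + LSW Lemma 3.2 on filled ranges + SLE_(8/3)
simplicity) ∧ 'no retracing' (a near-self-approach estimate for x_c-SAW). [difficulty: open-problem] -/
@[route_item "route-CriticalPhenomena-SAWPoissonBanks"]
def SimpleSubseqLimits : Prop :=
  ∀ (D : Literature.Probability.RandomPlanarGeometry.DobrushinDomain) (a b : ℝ → Literature.Probability.LatticeModels.Site 2), Literature.Probability.RandomPlanarGeometry.SAW.IsEndpointApprox D a b → ∀ (s : ℕ → ℝ) (ν : MeasureTheory.Measure (Literature.Probability.RandomPlanarGeometry.CurveClass ℂ)), Filter.Tendsto s Filter.atTop (nhdsWithin 0 (Set.Ioi 0)) → MeasureTheory.IsProbabilityMeasure ν → (∀ f : BoundedContinuousFunction (Literature.Probability.RandomPlanarGeometry.CurveClass ℂ) ℝ, Filter.Tendsto (fun n => ∫ γ, f γ.curve ∂(Literature.Probability.RandomPlanarGeometry.SAW.law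 D.carrier (s n) (a (s n)) (b (s n)))) Filter.atTop (nhds (∫ x, f x ∂ν))) → ∀ᵐ γ ∂ν, γ ∈ Literature.Probability.RandomPlanarGeometry.CurveClass.simple ∧ γ.source = D.pt 0 ∧ γ.target = D.pt 1 ∧ γ.range ⊆ closure D.carrier ∧ γ.range ∩ frontier D.carrier ⊆ {D.pt 0, D.pt 1}

-- parent: LimitExists · child (gen 1)
/--     item stmt-CriticalPhenomena-1369 · crux · rank 503 · open
    parent: LimitExists · by planner
    why it might fail: Full-filter limit of a ratio Z_δ(D')/Z_δ(D) of critical SAW generating functions with no monotonicity in δ — a scalar scaling limit whose only known road to existence is the conformal value (5/8 law); Kennedy–Lawler boundary factors cancel only because D, D' agree near a, b.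
    sources: LawlerSchrammWerner2004SAW, KennedyLawler2013, arXiv:1008.4321, arXiv:1109.3091
[crux] the one extra (value-free) scalar lattice input of the card (its r3): for Dobrushin D' ⊆ D
with the same marked points and agreeing with D near a and b, and any endpoint approximation, the
critical SAW probability P_δ(curve ⊆ closure D') (= Z_δ(D')/Z_δ(D) up to largest-component
bookkeeping) converges as δ → 0+ along the FULL filter to some c ∈ [0,1] (no claim on the value;
LSW04 Prediction: a conformal quantity to the power 5/8). With AvoidanceDeterminesLaw it makes
subsequential curve limits unique, hence gives the full limit (LimitExists) and its dilation
covariance. Sources: LawlerSchrammWerner2004SAW (arXiv:math/0204277 §3.4.2–3.4.5, §4.1),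
KennedyLawler2013 (arXiv:1109.3091 §1), arXiv:1008.4321 §3.1. -/
@[route_item "route-CriticalPhenomena-SAWPoissonBanks"]
def AvoidanceCocycleLimit : Prop :=
  ∀ (D D' : Literature.Probability.RandomPlanarGeometry.DobrushinDomain) (a b : ℝ → Literature.Probability.LatticeModels.Site 2), Literature.Probability.RandomPlanarGeometry.SAW.IsEndpointApprox D a b → D'.carrier ⊆ D.carrier → D'.pt 0 = D.pt 0 → D'.pt 1 = D.pt 1 → (∃ ε : ℝ, 0 < ε ∧ D'.carrier ∩ Metric.ball (D.pt 0) ε = D.carrier ∩ Metric.ball (D.pt 0) ε ∧ D'.carrier ∩ Metric.ball (D.pt 1) ε = D.carrier ∩ Metric.ball (D.pt 1) ε) → ∃ c : ENNReal, Filter.Tendsto (fun δ => (((Literature.Probability.RandomPlanarGeometry.SAW.law D.carrier δ (a δ) (b δ)).map (fun γ => γ.curve)) (Literature.Probability.RandomPlanarGeometry.CurveClass.rangeSubset (closure D'.carrier)))) (nhdsWithin 0 (Set.Ioi 0)) (nhds c)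

-- parent: LimitExists · glue (gen 1)
/--     item stmt-CriticalPhenomena-20232 · support · rank 504 · open
    parent: LimitExists · GLUE: children ⟹ parent · by operator
glue of the T/S/C split of LimitExists: EventualTight → SimpleSubseqLimits → AvoidanceCocycleLimit →
LimitExists. ALREADY PROVED for the defeq SAWRestrictionRigidity decls as
Summit.CriticalPhenomena.SAWScalingLimit.Theorems.SAWRestrictionRigidityLimitExists.LimitExists_of_items
(p145872: Prokhorov extraction under eventual tightness + AvoidanceDeterminesLaw pins every
subsequential limit by the avoidance cocycle + interleaving of approximations); a prover closes this
item with a one-line Theorems file `exact LimitExists_of_items hT hS hC` (children and parent are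
the same normalised signatures). [difficulty: XS] -/
@[route_item "route-CriticalPhenomena-SAWPoissonBanks"]
def LimitExistsOfTSC : Prop :=
  EventualTight → SimpleSubseqLimits → AvoidanceCocycleLimit → LimitExists

/-- item stmt-CriticalPhenomena-3017 · support · rank 9 · closed · proved by Summit.CriticalPhenomena.SAWScalingLimit.Theorems.LSWSimpleRestrictionIsSLE_proof @ db6b0749abc7 (prover) · by planner
sources: LawlerSchrammWerner2003Restriction, RohdeSchramm2005, Lawler2005
[support] LSW03 classification in HYPOTHESIS-FREE form (route repair 2026-08-15; implies the shared
item stmt-CriticalPhenomena-0775 = LSWRestrictionFact verbatim, see planner Sketch.lean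
`lsw_new_implies_old`): a chordal family on Dobrushin domains that is chordal, conformally covariant
(ChordalFamily.IsConformallyCovariant), has the two-sided restriction property
(ChordalFamily.IsRestriction) and is carried by simple curves meeting ∂D only at the two marked
points is, in every domain, the chordal SLE_{8/3} law (IsSLELaw (8/3)). The named-fact hypotheses of
stmt-0775 are dropped because they are not needed at κ = 8/3: existence is the library THEOREM
Literature.Probability.RandomPlanarGeometry.exists_isSLECurve_eightThirds (SLEExistenceNeEightHolds;
Rohde–Schramm Thm 5.1 + Thm 7.1; axiom closure propext/choice/Quot.sound checked), uniqueness in law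
is IsSLECurve.map_eq_holds (SLEUniquenessInLaw); `exists_isSLECurve` for ALL κ is equivalent to the
unproved SLE₈ trace theorem (hasSLETrace_eight, SLETransienceIffTrace) and must not burden an
SLE_{8/3} route. Sources: LawlerSchrammWerner2003Restriction (arXiv:math/0209343: p.5 results 1–2,
Prop. 3.3, Thm 6.1, Cor. 8.6), RohdeSchramm20 -/
@[route_item "route-CriticalPhenomena-SAWPoissonBanks", crux]
def LSWSimpleRestrictionIsSLE : Prop :=
  ∀ P : Literature.Probability.RandomPlanarGeometry.ChordalFamily, P.IsChordal → P.IsConformallyCovariant → P.IsRestriction → (∀ D : Literature.Probability.RandomPlanarGeometry.DobrushinDomain, ∀ᵐ γ ∂(P D), γ ∈ Literature.Probability.RandomPlanarGeometry.CurveClass.simple ∧ γ.range ∩ frontier D.carrier ⊆ {D.pt 0, D.pt 1}) → ∀ D : Literature.Probability.RandomPlanarGeometry.DobrushinDomain, Literature.Probability.RandomPlanarGeometry.IsSLELaw ((8 : NNReal) / 3) D (P D)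

/-- item stmt-CriticalPhenomena-4778 · support · rank 9 · open · by planner
sources: BillingsleyCPM1999, LawlerSchrammWerner2004SAW, Molchanov2017
[support] passage to the limit (card item r5): PoissonianBanks implies that every chordal family
arising as the full scaling limit of the critical SAW laws satisfies the exact alternation tower on
both sides in every Dobrushin domain — finite products of probabilities of the closed events {range
⊆ cl B ∩ ⋂ cl F_i} converge by portmanteau once the limit gives zero mass to curves touching a hull
boundary without entering (the same null-touching lemma as the restriction passage inside
AxiomsOfLimit). [difficulty: M] -/
@[route_item "route-CriticalPhenomena-SAWPoissonBanks", crux]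
def BanksOfLimit : Prop :=
  PoissonianBanks → ∀ P : Literature.Probability.RandomPlanarGeometry.ChordalFamily, P.IsChordal → (∀ (D : Literature.Probability.RandomPlanarGeometry.DobrushinDomain) (a b : ℝ → Literature.Probability.LatticeModels.Site 2), Literature.Probability.RandomPlanarGeometry.SAW.IsEndpointApprox D a b → Literature.Probability.RandomPlanarGeometry.TendstoLaw (fun δ (γ : Literature.Probability.RandomPlanarGeometry.SAW.DomainSAW D.carrier δ (a δ) (b δ)) => γ.curve) (fun δ => Literature.Probability.RandomPlanarGeometry.SAW.law D.carrier δ (a δ) (b δ)) id (P D)) → (∀ (D : Literature.Probability.RandomPlanarGeometry.DobrushinDomain), ∀ (j : Fin 2) (B : Literature.Probability.RandomPlanarGeometry.DobrushinDomain) (n : ℕ) (F : Fin (n + 1) → Literature.Probability.RandomPlanarGeometry.DobrushinDomain), (B.carrier ⊆ D.carrier ∧ B.pt 0 = D.pt 0 ∧ B.pt 1 = D.pt 1 ∧ D.arc j ⊆ frontier B.carrier ∧ (∃ ε : ℝ, 0 < ε ∧ B.carrier ∩ Metric.ball (D.pt 0) ε = D.carrier ∩ Metric.ball (D.pt 0)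 ε ∧ B.carrier ∩ Metric.ball (D.pt 1) ε = D.carrier ∩ Metric.ball (D.pt 1) ε)) → (∀ i, ((F i).carrier ⊆ D.carrier ∧ (F i).pt 0 = D.pt 0 ∧ (F i).pt 1 = D.pt 1 ∧ D.arc j ⊆ frontier (F i).carrier ∧ (∃ ε : ℝ, 0 < ε ∧ (F i).carrier ∩ Metric.ball (D.pt 0) ε = D.carrier ∩ Metric.ball (D.pt 0) ε ∧ (F i).carrier ∩ Metric.ball (D.pt 1) ε = D.carrier ∩ Metric.ball (D.pt 1) ε))) → (∏ S ∈ (Finset.univ : Finset (Finset (Fin (n + 1)))).filter (fun S => Odd S.card), P D (Literature.Probability.RandomPlanarGeometry.CurveClass.rangeSubset (closure B.carrier) ∩ ⋂ i ∈ S, Literature.Probability.RandomPlanarGeometry.CurveClass.rangeSubset (closure (F i).carrier))) ≤ (∏ S ∈ (Finset.univ : Finset (Finset (Fin (n + 1)))).filter (fun S => Even S.card), P D (Literature.Probability.RandomPlanarGeometry.CurveClass.rangeSubset (closure B.carrier) ∩ ⋂ i ∈ S, Literature.Probability.RandomPlanarGeometry.CurveClass.rangeSubset (closure (F i).carrier)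)))

/-- item stmt-CriticalPhenomena-4779 · support · rank 9 · open · by planner
sources: Werner2005ConformalRestriction, LawlerSchrammWerner2004SAW, KennedyLawler2013, arXiv:1008.4321
[support] the card's quantitative order-2 shadow PB₂ in conformal form (not used by the assembly;
filed as the route's typed falsifier and as the bridge to the 5/8-law cards): for two
hull-complements F₁, F₂ of D on the same side, the SAW log-covariance ratio q_δ(E₁ ∩
E₂)/(q_δ(E₁)·q_δ(E₂)) converges as δ → 0⁺ to the same ratio under the chordal SLE_8/3 law of D — by
Werner's theorem the exponential of (5/8)·(mutual Brownian-excursion mass of the two hulls),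
computable on the lattice as (5/8)·c₀⁻¹·(mutual random-walk-excursion mass) with no conformal map.
[difficulty: XL] -/
@[route_item "route-CriticalPhenomena-SAWPoissonBanks"]
def MutualAvoidanceLaw : Prop :=
  ∀ (D : Literature.Probability.RandomPlanarGeometry.DobrushinDomain) (a b : ℝ → Literature.Probability.LatticeModels.Site 2), Literature.Probability.RandomPlanarGeometry.SAW.IsEndpointApprox D a b → ∀ (j : Fin 2) (F₁ F₂ : Literature.Probability.RandomPlanarGeometry.DobrushinDomain), (F₁.carrier ⊆ D.carrier ∧ F₁.pt 0 = D.pt 0 ∧ F₁.pt 1 = D.pt 1 ∧ D.arc j ⊆ frontier F₁.carrier ∧ (∃ ε : ℝ, 0 < ε ∧ F₁.carrier ∩ Metric.ball (D.pt 0) ε = D.carrier ∩ Metric.ball (D.pt 0) ε ∧ F₁.carrier ∩ Metric.ball (D.pt 1) ε = D.carrier ∩ Metric.ball (D.pt 1) ε)) → (F₂.carrier ⊆ D.carrier ∧ F₂.pt 0 = D.pt 0 ∧ F₂.pt 1 = D.pt 1 ∧ D.arc j ⊆ frontier F₂.carrier ∧ (∃ ε : ℝ, 0 < ε ∧ F₂.carrier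 ∩ Metric.ball (D.pt 0) ε = D.carrier ∩ Metric.ball (D.pt 0) ε ∧ F₂.carrier ∩ Metric.ball (D.pt 1) ε = D.carrier ∩ Metric.ball (D.pt 1) ε)) → ∀ μ : MeasureTheory.Measure (Literature.Probability.RandomPlanarGeometry.CurveClass ℂ), Literature.Probability.RandomPlanarGeometry.IsSLELaw ((8 : NNReal) / 3) D μ → Filter.Tendsto (fun δ => (((Literature.Probability.RandomPlanarGeometry.SAW.law D.carrier δ (a δ) (b δ)).map (fun γ => γ.curve)) (Literature.Probability.RandomPlanarGeometry.CurveClass.rangeSubset (closure F₁.carrier) ∩ Literature.Probability.RandomPlanarGeometry.CurveClass.rangeSubset (closure F₂.carrier))).toReal / ((((Literature.Probability.RandomPlanarGeometry.SAW.law D.carrier δ (a δ) (b δ)).map (fun γ => γ.curve)) (Literature.Probability.RandomPlanarGeometry.CurveClass.rangeSubset (closure F₁.carrier))).toReal * (((Literature.Probability.RandomPlanarGeometry.SAW.law D.carrier δ (a δ) (b δ)).map (fun γ => γ.curve)) (Literature.Probability.RandomPlanarGeometry.CurveClass.rangeSubset (closure F₂.carrier))).toReal)) (nhdsWithin (0 :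 ℝ) (Set.Ioi 0)) (nhds ((μ (Literature.Probability.RandomPlanarGeometry.CurveClass.rangeSubset (closure F₁.carrier) ∩ Literature.Probability.RandomPlanarGeometry.CurveClass.rangeSubset (closure F₂.carrier))).toReal / ((μ (Literature.Probability.RandomPlanarGeometry.CurveClass.rangeSubset (closure F₁.carrier))).toReal * (μ (Literature.Probability.RandomPlanarGeometry.CurveClass.rangeSubset (closure F₂.carrier))).toReal)))

/-- item stmt-CriticalPhenomena-4780 · assembly · rank 1 · closed · proved by Summit.CriticalPhenomena.SAWScalingLimit.Theorems.poissonBanks_assembly_proof (prover) · by planner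
sources: LawlerSchrammWerner2003Restriction, LawlerSchrammWerner2004SAW, Werner2005ConformalRestriction
[assembly] LSWSimpleRestrictionIsSLE → PoissonRigidity → PoissonianBanks → BanksOfLimit →
LimitExists → AxiomsOfLimit → SAWScalingLimit. -/
@[route_item "route-CriticalPhenomena-SAWPoissonBanks"]
def Assembly : Prop :=
  LSWSimpleRestrictionIsSLE → PoissonRigidity → PoissonianBanks → BanksOfLimit → LimitExists → AxiomsOfLimit → SAWScalingLimit

/-! D-0027 §2.1 — DECIDING THEOREM (planner-authored via `route open/edit --closes-file`; by planner-rbadge-CriticalPhenomena-SAWPoissonBan-be61bc34-g4-0 2026-08-15T16:10:42Z):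
its hypotheses are this route's items and its conclusion the sub-problem Statement (glue_lint), and it elaborates with this file. -/

@[closes "route-CriticalPhenomena-SAWPoissonBanks"] theorem closes (h_LSWSimpleRestrictionIsSLE : LSWSimpleRestrictionIsSLE)
    (h_PoissonRigidity : PoissonRigidity) (h_PoissonianBanks : PoissonianBanks)
    (h_BanksOfLimit : BanksOfLimit) (h_LimitExists : LimitExists)
    (h_AxiomsOfLimit : AxiomsOfLimit) : _root_.SAWScalingLimit := by
  intro D a b hab
  obtain ⟨P, hP, hlim⟩ := h_LimitExists
  obtain ⟨hR, hM, hrev, hsim, hconj, hsimple⟩ := h_AxiomsOfLimit P hP hlim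
  have hbanks := h_BanksOfLimit h_PoissonianBanks P hP hlim
  have hcc : P.IsConformallyCovariant :=
    h_PoissonRigidity P hP hR hM hrev hsim hconj hsimple hbanks
  obtain ⟨Γ, hΓ, hPD⟩ := h_LSWSimpleRestrictionIsSLE P hP hcc hR hsimple D
  refine ⟨Γ, hΓ, Filter.Eventually.of_forall fun δ =>
    Literature.Probability.RandomPlanarGeometry.SAW.aemeasurable_curve _ _ _ _, ?_⟩
  intro f
  have h := hlim D a b hab f
  rw [hPD] at h
  simp only [id] at h
  rwa [MeasureTheory.integral_map hΓ.1 f.continuous.aestronglyMeasurable] at h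

end Summit.CriticalPhenomena.SAWScalingLimit.Theses.SAWPoissonBanks
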